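import Mathlib
import Summits.Ventures.PercRepro2.HCov
import Summits.Ventures.PercRepro2.EdgeCubic
import Summits.Ventures.PercRepro2.EdgeCubicAll
import Summits.Ventures.PercRepro2.CPolarA3
import Summits.Ventures.PercRepro2.CPolarA3Marks
import Summits.Ventures.PercRepro2.PendantClusterPins
import Summits.Ventures.PercRepro2.PendantClusterBern
import Summits.Ventures.PercRepro2.CPolarA3Exists
import Summits.Ventures.PercRepro2.ClusterRootBern
import Summits.Ventures.PercRepro2.EdgeReloc
import Summits.Ventures.PercRepro2.ReachRootEdge
import Summits.Ventures.PercRepro2.CPolarSub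

/-!
# THE LITERAL FORM: (SUB) need only be asked at instances whose fractional reach-edges are all
incident to `a₃` (blind cell PercRepro2, p5 g16; `proofs/P5-OEDGE.md` §20)

By EdgeReloc.lean a fractional edge `{u, z}` with `z` in the pinned-open reach of `a₃` can be moved
to `{u, a₃}` without changing any connection almost surely. Doing this to every fractional edge
touching the reach but not incident to `a₃` (`relocCount` many) produces an edge map in which the
contracted `a₃` IS `a₃`: every fractional reach-edge is a literal `a₃`-edge. The per-edge
hypothesis `GoodEdgeSub` transfers back along one relocation (`goodEdgeSub_of_reloc`): reach-root
edges by the unchanged reaches, pendant-PA edges by the unchanged touching relation and the mass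
congruences, `0 ≤ B1 ∧ 0 ≤ B2` and `PinsPos ∧ Sub1 ∧ Sub2` by `B1_congr` / `B2_congr` /
`Gc_congr` at the pins of the OTHER edge (`conn_reloc_iff_ae'`: a weight vector that keeps the
weight-`1` edges of `p` other than `e` at weight `1` sees the relocation as invisible). Hence
**`cpolarA3Sub_all_of_lit : CPolarA3SubLit_all R → CPolarA3Sub_all R`** and
**`HCov_all_of_cpolarA3SubLit_all`** — the crux from (SUB) at one LITERAL `a₃`-edge per mark-free
instance in which every fractional reach-edge is incident to `a₃` (reach-root and pendant-PA edges
free).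
-/

namespace Summit.Ventures.PercRepro2

open UnionCluster CovForm CovForm.CPolarA3 PendantCluster CPolarA3Exists ClusterRoot ReachRoot
  EdgeReloc CPolarSub

namespace CPolarSubLit

/-! ## Relocation is invisible to every weight vector keeping the other weight-`1` edges -/

section AE

variable {V : Type*} {E : Type*} [Fintype E] [DecidableEq E] {R : Type*} [Field R]
  [LinearOrder R]

/-- `pinnedConfig_le_update_false` with the weaker hypothesis: `q` keeps every weight-`1` edge of
`p` other than `e` at weight `1`. -/
lemma pinnedConfig_le_update_false' {p q : E → R} {e : E}
    (hq : ∀ e', e' ≠ e → p e' = 1 → q e' = 1) (hf1 : p e ≠ 1) {ω : Config E}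
    (hw : weight q ω ≠ 0) : pinnedConfig p ≤ Function.update ω e false := by
  intro e'
  by_cases hee : e' = e
  · subst hee
    have h : pinnedConfig p e' = false := by
      unfold pinnedConfig; rw [decide_eq_false_iff_not]; exact hf1
    rw [h]; exact Bool.false_le _
  · rw [Function.update_of_ne hee]
    by_cases h1 : p e' = 1
    · rw [open_of_weight_ne_zero hw (hq e' hee h1)]; exact Bool.le_true _
    · have h : pinnedConfig p e' = false := by
        unfold pinnedConfig; rw [decide_eq_false_iff_not]; exact h1
      rw [h]; exact Bool.false_le _

/-- **Relocation almost surely, for any weight vector keeping the other weight-`1` edges of `p`**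
(in particular for the pins of any OTHER fractional edge). -/
lemma conn_reloc_iff_ae' {p q : E → R} {ends : E → Sym2 V} {e : E} {u z a₁ : V}
    (hq : ∀ e', e' ≠ e → p e' = 1 → q e' = 1) (hf1 : p e ≠ 1) (hu : u ∈ pinnedReach p ends a₁)
    (he : ends e = s(u, z)) {ω : Config E} (hw : weight q ω ≠ 0) (x y : V) :
    Conn ends ω x y ↔ Conn (Function.update ends e s(a₁, z)) ω x y :=
  conn_reloc_iff he (conn_symm (conn_mono (pinnedConfig_le_update_false' hq hf1 hw) hu)) x y

omit [Fintype E] [LinearOrder R] in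
/-- The pins of a fractional edge `e'` keep every weight-`1` edge of `p` other than `e`. -/
lemma update_keeps_one (p : E → R) (e e' : E) (c : R) (hf1' : p e' ≠ 1) :
    ∀ e'', e'' ≠ e → p e'' = 1 → Function.update p e' c e'' = 1 := by
  intro e'' _ h1
  have hne : e'' ≠ e' := fun h => hf1' (h ▸ h1)
  rw [Function.update_of_ne hne]; exact h1

omit [Fintype E] [DecidableEq E] [LinearOrder R] in
/-- `p` itself keeps its weight-`1` edges. -/
lemma self_keeps_one (p : E → R) (e : E) : ∀ e'', e'' ≠ e → p e'' = 1 → p e'' = 1 :=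
  fun _ _ h => h

end AE

/-! ## What one relocation preserves -/

section Transfer

variable {V : Type*} {E : Type*} [Fintype V] [DecidableEq V] [Fintype E] [DecidableEq E]
  {R : Type*} [Field R] [LinearOrder R] [IsStrictOrderedRing R]

open EdgeLine

variable {p : E → R} {ends : E → Sym2 V} {e : E} {a₃ z u : V}

omit [Fintype V] [DecidableEq V] [Fintype E] [IsStrictOrderedRing R] in
/-- Touching the reach of `a₃` is unchanged by relocating the end `z ∈ reach(a₃)` of `e` to `a₃`. -/
lemma touchesReach_reloc_iff (hf1 : p e ≠ 1) (hz : z ∈ pinnedReach p ends a₃)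
    (he : ends e = s(z, u)) (e' : E) :
    TouchesReach p (Function.update ends e s(a₃, u)) a₃ e' ↔ TouchesReach p ends a₃ e' := by
  unfold TouchesReach
  rw [pinnedReach_reloc p hf1]
  by_cases hee : e' = e
  · subst hee
    rw [Function.update_self, he]
    constructor
    · intro _; exact ⟨z, Sym2.mem_mk_left z u, hz⟩
    · intro _; exact ⟨a₃, Sym2.mem_mk_left a₃ u, self_mem_pinnedReach⟩
  · rw [Function.update_of_ne hee]

omit [Fintype V] [DecidableEq V] [Fintype E] [IsStrictOrderedRing R] in
/-- Mark-freeness is unchanged by a relocation (the reaches are). -/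
lemma markFree_reloc_iff (hf1 : p e ≠ 1) (o a₁ a₂ b : V) :
    MarkFree p (Function.update ends e s(a₃, u)) o a₁ a₂ a₃ b ↔ MarkFree p ends o a₁ a₂ a₃ b := by
  unfold MarkFree
  rw [pinnedReach_reloc p hf1]

omit [Fintype V] [DecidableEq V] [Fintype E] [DecidableEq E] [IsStrictOrderedRing R] in
/-- The reach is transitive: the reach of a vertex of the reach of `a₃` lies in the reach of `a₃`. -/
lemma mem_pinnedReach_trans {v w : V} (hv : v ∈ pinnedReach p ends w) {r : V}
    (hw : w ∈ pinnedReach p ends r) : v ∈ pinnedReach p ends r :=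
  conn_trans hw hv

omit [Fintype V] [DecidableEq V] [Fintype E] [IsStrictOrderedRing R] in
/-- A reach-root edge of the relocated map is a reach-root edge of the original map. -/
lemma isReachRootEdge_of_reloc (hf1 : p e ≠ 1) (hz : z ∈ pinnedReach p ends a₃)
    (he : ends e = s(z, u)) (a₁ a₂ : V) (e' : E)
    (h : IsReachRootEdge p (Function.update ends e s(a₃, u)) a₁ a₂ a₃ e') :
    IsReachRootEdge p ends a₁ a₂ a₃ e' := by
  obtain ⟨z', hz', u', hu', hends⟩ := h
  rw [pinnedReach_reloc p hf1] at hz'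
  rw [pinnedReach_reloc p hf1, pinnedReach_reloc p hf1] at hu'
  by_cases hee : e' = e
  · subst hee
    rw [Function.update_self] at hends
    -- `{u', z'} = {a₃, u}`
    have hcases : (a₃ = u' ∧ u = z') ∨ (u = u' ∧ a₃ = z') := by
      rcases hends with h | h
      · rcases Sym2.eq_iff.1 h with ⟨h1, h2⟩ | ⟨h1, h2⟩
        · exact Or.inl ⟨h1, h2⟩
        · exact Or.inr ⟨h2, h1⟩
      · rcases Sym2.eq_iff.1 h with ⟨h1, h2⟩ | ⟨h1, h2⟩
        · exact Or.inr ⟨h2, h1⟩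
        · exact Or.inl ⟨h1, h2⟩
    rcases hcases with ⟨rfl, rfl⟩ | ⟨rfl, rfl⟩
    · -- `a₃` lies in a root's reach, hence so does `z`; the edge `{z, u}` has `u ∈ reach(a₃)`
      refine ⟨u, hz', z, ?_, Or.inr (by rw [he, Sym2.eq_swap])⟩
      rcases hu' with hu' | hu'
      · exact Or.inl (mem_pinnedReach_trans hz hu')
      · exact Or.inr (mem_pinnedReach_trans hz hu')
    · exact ⟨z, hz, u, hu', Or.inr he⟩
  · rw [Function.update_of_ne hee] at hends
    exact ⟨z', hz', u', hu', hends⟩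

omit [Fintype V] [DecidableEq V] [IsStrictOrderedRing R] in
/-- The connections of the relocated map agree with those of `ends` almost surely for `p` and for
the pins of every fractional edge. -/
lemma hH_of_reloc (hf1 : p e ≠ 1) (hz : z ∈ pinnedReach p ends a₃) (he : ends e = s(z, u))
    {q : E → R} (hq : ∀ e'', e'' ≠ e → p e'' = 1 → q e'' = 1) :
    ∀ ω, weight q ω ≠ 0 → ∀ x y, Conn ends ω x y ↔ Conn (Function.update ends e s(a₃, u)) ω x y :=
  fun _ hw x y => conn_reloc_iff_ae' hq hf1 hz he hw x y

omit [Fintype V] [DecidableEq V] [IsStrictOrderedRing R] in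
/-- A pendant-PA edge of the relocated map is a pendant-PA edge of the original map. -/
lemma pendantPA_of_reloc (hf1 : p e ≠ 1) (hz : z ∈ pinnedReach p ends a₃)
    (he : ends e = s(z, u)) (o a₁ a₂ : V) (e' : E)
    (h : PendantPA p (Function.update ends e s(a₃, u)) o a₁ a₂ a₃ e') :
    PendantPA p ends o a₁ a₂ a₃ e' := by
  obtain ⟨huniq, z', u', hends, hz', hu', hD, hcov⟩ := h
  have hH := hH_of_reloc hf1 hz he (self_keeps_one p e)
  rw [pinnedReach_reloc p hf1] at hz' hu'
  refine ⟨fun e'' he'' ht => huniq e'' he'' ((touchesReach_reloc_iff hf1 hz he e'').2 ht), ?_⟩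
  -- the masses of the relocated map are those of `ends`
  have hD' : 0 < prob p (PDEvent ends a₁ a₂ u') := by rw [prob_PD hH]; exact hD
  have hcov' : prob p (avoidAll ends a₂ {a₁}) * Do p ends o a₁ a₂ u' ≤
      (prob p (avoidAll ends a₂ {a₁} ∩ connEvent ends a₁ o) +
        prob p (avoidAll ends a₂ {a₁} ∩ connEvent ends a₂ o)) * prob p (PDEvent ends a₁ a₂ u') := by
    unfold Do
    rw [prob_Q hH, prob_PD_c hH, prob_PD_c hH, prob_Q_c hH, prob_Q_c hH, prob_PD hH]
    unfold Do at hcov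
    exact hcov
  by_cases hee : e' = e
  · subst hee
    rw [Function.update_self] at hends
    -- `{z', u'} = {a₃, u}` with `u' ∉ reach`, so `z' = a₃`, `u' = u`
    have hcases : (a₃ = z' ∧ u = u') ∨ (u = z' ∧ a₃ = u') := by
      rcases Sym2.eq_iff.1 hends with ⟨h1, h2⟩ | ⟨h1, h2⟩
      · exact Or.inl ⟨h1, h2⟩
      · exact Or.inr ⟨h2, h1⟩
    rcases hcases with ⟨rfl, rfl⟩ | ⟨rfl, rfl⟩
    · exact ⟨z, u, he, hz, hu', hD', hcov'⟩
    · exact absurd self_mem_pinnedReach hu'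
  · rw [Function.update_of_ne hee] at hends
    exact ⟨z', u', hends, hz', hu', hD', hcov'⟩

omit [Fintype V] [DecidableEq V] [IsStrictOrderedRing R] in
/-- **One relocation transfers `GoodEdgeSub` back** (for any fractional edge `e'`). -/
theorem goodEdgeSub_of_reloc (hf1 : p e ≠ 1) (hz : z ∈ pinnedReach p ends a₃)
    (he : ends e = s(z, u)) (o a₁ a₂ b : V) (e' : E) (hf1' : p e' ≠ 1)
    (h : GoodEdgeSub p (Function.update ends e s(a₃, u)) o a₁ a₂ a₃ b e') :
    GoodEdgeSub p ends o a₁ a₂ a₃ b e' := by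
  have hH₀ := hH_of_reloc hf1 hz he (update_keeps_one p e e' 0 hf1')
  have hH₁ := hH_of_reloc hf1 hz he (update_keeps_one p e e' 1 hf1')
  rcases h with (hr | hpa | ⟨hB1, hB2⟩) | ⟨hpos, h1, h2⟩
  · exact Or.inl (Or.inl (isReachRootEdge_of_reloc hf1 hz he a₁ a₂ e' hr))
  · exact Or.inl (Or.inr (Or.inl (pendantPA_of_reloc hf1 hz he o a₁ a₂ e' hpa)))
  · refine Or.inl (Or.inr (Or.inr ⟨?_, ?_⟩))
    · rw [B1_congr hH₀ hH₁]; exact hB1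
    · rw [B2_congr hH₀ hH₁]; exact hB2
  · refine Or.inr ⟨?_, ?_, ?_⟩
    · unfold PinsPos at hpos ⊢
      rw [prob_Q hH₀, prob_PD hH₀]; exact hpos
    · unfold Sub1 at h1 ⊢
      rw [prob_Q hH₁, prob_PD hH₀, prob_Q hH₀, prob_PD hH₁, Gc_congr hH₀, B1_congr hH₀ hH₁]
      exact h1
    · unfold Sub2 at h2 ⊢
      rw [prob_Q hH₁, prob_PD hH₁, prob_Q hH₀, prob_PD hH₀, Gc_congr hH₀, B2_congr hH₀ hH₁]
      exact h2

end Transfer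

/-! ## The literal form -/

section Lit

variable (R : Type*) [Field R] [LinearOrder R] [IsStrictOrderedRing R]

/-- **(SUB) at one LITERAL `a₃`-edge per mark-free instance whose fractional reach-edges are all
incident to `a₃`** (reach-root and pendant-PA edges free). -/
def CPolarA3SubLit_all : Prop :=
  ∀ (V E : Type) [Fintype V] [DecidableEq V] [Fintype E] [DecidableEq E]
    (ends : E → Sym2 V) (p : E → R), IsProbVec p →
    ∀ o a₁ a₂ a₃ b : V, a₁ ≠ a₂ → a₁ ≠ a₃ → a₂ ≠ a₃ → o ≠ a₁ → o ≠ a₂ → o ≠ a₃ → o ≠ b →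
      b ≠ a₁ → b ≠ a₂ → b ≠ a₃ → MarkFree p ends o a₁ a₂ a₃ b →
      (∀ e ∈ fracEdges p, TouchesReach p ends a₃ e → a₃ ∈ ends e) →
      (∃ e ∈ fracEdges p, TouchesReach p ends a₃ e) →
      ∃ e ∈ fracEdges p, TouchesReach p ends a₃ e ∧ GoodEdgeSub p ends o a₁ a₂ a₃ b e

omit [IsStrictOrderedRing R] in
/-- `CPolarA3SubLit_all` is weaker than `CPolarA3Sub_all`. -/
theorem cpolarA3SubLit_all_of_cpolarA3Sub_all (h : CPolarA3Sub_all R) : CPolarA3SubLit_all R :=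
  fun V E _ _ _ _ ends p hp o a₁ a₂ a₃ b h1 h2 h3 h4 h5 h6 h7 h8 h9 h10 hfree _ hex =>
    h V E ends p hp o a₁ a₂ a₃ b h1 h2 h3 h4 h5 h6 h7 h8 h9 h10 hfree hex

omit [IsStrictOrderedRing R] in
/-- **The literal form suffices**: relocate the fractional reach-edges not incident to `a₃` one by
one (each relocation is invisible to every mass, reach and Bernstein coefficient). -/
theorem cpolarA3Sub_all_of_lit (h : CPolarA3SubLit_all R) : CPolarA3Sub_all R := by
  intro V E _ _ _ _ ends p hp o a₁ a₂ a₃ b h1 h2 h3 h4 h5 h6 h7 h8 h9 h10 hfree hex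
  classical
  -- induction on the number of fractional reach-edges not incident to `a₃`
  generalize hn : ((fracEdges p).filter fun e => TouchesReach p ends a₃ e ∧ a₃ ∉ ends e).card = n
  induction n using Nat.strong_induction_on generalizing ends with
  | _ n ih =>
    by_cases hlit : ∀ e ∈ fracEdges p, TouchesReach p ends a₃ e → a₃ ∈ ends e
    · exact h V E ends p hp o a₁ a₂ a₃ b h1 h2 h3 h4 h5 h6 h7 h8 h9 h10 hfree hlit hex
    · simp only [not_forall, exists_prop] at hlit
      obtain ⟨e, he, ht, hna⟩ := hlit
      have hfe : p e ≠ 0 ∧ p e ≠ 1 := by simpa [fracEdges] using he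
      obtain ⟨z, hze, hz⟩ := ht
      -- the other end `u` of `e`
      obtain ⟨u, hu⟩ : ∃ u, ends e = s(z, u) := by
        induction hends : ends e using Sym2.ind with
        | _ x y =>
          rw [hends] at hze
          rcases Sym2.mem_iff.1 hze with rfl | rfl
          · exact ⟨y, rfl⟩
          · exact ⟨x, Sym2.eq_swap⟩
      set ends' := Function.update ends e s(a₃, u) with hends'
      -- the count drops by one
      have hfilter : ((fracEdges p).filter fun e' => TouchesReach p ends' a₃ e' ∧ a₃ ∉ ends' e') =
          ((fracEdges p).filter fun e' => TouchesReach p ends a₃ e' ∧ a₃ ∉ ends e').erase e := by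
        ext e'
        simp only [Finset.mem_filter, Finset.mem_erase]
        by_cases hee : e' = e
        · subst hee
          simp only [hends', Function.update_self, Sym2.mem_mk_left, not_true_eq_false, and_false,
            ne_eq, not_true_eq_false, false_and]
        · simp only [hends', Function.update_of_ne hee, touchesReach_reloc_iff hfe.2 hz hu e',
            ne_eq, hee, not_false_eq_true, true_and]
      have hmem : e ∈ (fracEdges p).filter fun e' => TouchesReach p ends a₃ e' ∧ a₃ ∉ ends e' :=
        Finset.mem_filter.2 ⟨he, ⟨z, hze, hz⟩, hna⟩
      have hlt : ((fracEdges p).filter fun e' => TouchesReach p ends' a₃ e' ∧ a₃ ∉ ends' e').card <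
          n := by
        rw [hfilter, ← hn]; exact Finset.card_erase_lt_of_mem hmem
      have hfree' : MarkFree p ends' o a₁ a₂ a₃ b := (markFree_reloc_iff hfe.2 o a₁ a₂ b).2 hfree
      have hex' : ∃ e' ∈ fracEdges p, TouchesReach p ends' a₃ e' := by
        obtain ⟨e', he', ht'⟩ := hex
        exact ⟨e', he', (touchesReach_reloc_iff hfe.2 hz hu e').2 ht'⟩
      obtain ⟨e', he', ht', hgood'⟩ := ih _ hlt ends' hfree' hex' rfl
      have hfe' : p e' ≠ 0 ∧ p e' ≠ 1 := by simpa [fracEdges] using he'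
      exact ⟨e', he', (touchesReach_reloc_iff hfe.2 hz hu e').1 ht',
        goodEdgeSub_of_reloc hfe.2 hz hu o a₁ a₂ b e' hfe'.2 hgood'⟩

/-- **(SUB) at one literal `a₃`-edge per instance of the literal class implies the crux.** -/
theorem HCov_all_of_cpolarA3SubLit_all (h : CPolarA3SubLit_all R) : HCov_all R :=
  HCov_all_of_cpolarA3Sub_all R (cpolarA3Sub_all_of_lit R h)

end Lit

end CPolarSubLit

end Summit.Ventures.PercRepro2
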